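import Literature.NumberTheory.LFunctions.WeilGroundState
import Literature.NumberTheory.LFunctions.WeilWindowSimpleEven
import Literature.NumberTheory.LFunctions.WeilGroundEnergyParitySplit
import Literature.NumberTheory.LFunctions.WeilWindowSuzukiProofs
import Mathlib.MeasureTheory.Group.Integral
import HarnessLib

/-!
# RiemannHypothesis / WeilGroundState — parity of operator-free Weil ground states
(reflection and normalised even part of a ground state are ground states)

Route `RiemannHypothesis/WeilGroundState`, crux item stmt-RiemannHypothesis-1527
(`GroundStatesConvergeToXi`), line `Sketch`, continuation lead c4 (helper file, `--supports`;
first half of the parity normal form of the crux, completed in `…EvenWitness`).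

The Weil form is reflection invariant (`weilQuadratic_comp_neg`) and parity-block-diagonal
(`weilQuadratic_eq_evenPart_add_oddPart`, Connes–Consani `QW_λ = QW_λ⁺ ⊕ QW_λ⁻`).  For the
operator-free ground states `IsWeilGroundState a u` (`L²`-limits of normalised minimising
sequences of window test functions) this gives, RH-free:

* `isWeilGroundState_comp_neg` — the reflection `u(-·)` of a ground state is a ground state at
  the same window (minimising sequence `gₙ(-·)`).
* `weilGroundEnergy_mul_integral_norm_sq_le` — `ε(a) ∫‖h‖² ≤ Re Q(h)` for every window test
  function `h` (Rayleigh bound `weilGroundEnergy_le_div`; `Q(0) = 0` in the degenerate case).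
* `integral_norm_sq_evenPart_add_oddPart_of_memLp` — Pythagoras for the parity splitting in `L²`,
  `∫‖fᵉ‖² + ∫‖fᵒ‖² = ∫‖f‖²` for `f ∈ L²` (the test-function case is the tree's
  `integral_norm_sq_evenPart_add_oddPart`, `WeilGroundEnergyParitySplit.lean`, Suzuki 2026 §4.5;
  pointwise parallelogram law `norm_sq_half_add_add_norm_sq_half_sub`, `∫‖f(-·)‖² = ∫‖f‖²).
* `isWeilGroundState_evenPart` — **the normalised EVEN PART of a ground state is a ground state**
  whenever it is non-zero in `L²`: along the minimising sequence `gₙ → u` with even/odd parts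
  `eₙ, oₙ` one has `Re Q(gₙ) = Re Q(eₙ) + Re Q(oₙ)`, `‖eₙ‖² + ‖oₙ‖² = 1`, hence
  `ε‖eₙ‖² ≤ Re Q(eₙ) ≤ Re Q(gₙ) - ε(1 - ‖eₙ‖²)`; and `‖eₙ - uᵉ‖₂ ≤ ‖gₙ - u‖₂ → 0`, so
  `‖eₙ‖² → ‖uᵉ‖² > 0`, `Re Q(eₙ) → ε‖uᵉ‖²`, and `eₙ/‖eₙ‖₂` (a tail of it) is an `L²`-normalised
  minimising sequence converging to `uᵉ/‖uᵉ‖₂`.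

(Likewise for the odd part; not needed.)  Mathlib + proved tree material only; no named fact; no
definitions; standard axioms.
-/

set_option linter.dupNamespace false

noncomputable section

open MeasureTheory Complex Filter Set
open scoped Real Topology

namespace Summit.RiemannHypothesis.RiemannHypothesis.Theorems.GroundStatesConvergeToXi

open Literature.NumberTheory.LFunctions

/-! ### Reflection `t ↦ -t` of window data -/

/-- A window support is reflection invariant: `tsupport g ⊆ [-a, a]` implies
`tsupport g(-·) ⊆ [-a, a]`. [folklore] -/
theorem tsupport_comp_neg_subset_Icc {g : ℝ → ℂ} {a : ℝ} (h : tsupport g ⊆ Icc (-a) a) :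
    tsupport (fun t ↦ g (-t)) ⊆ Icc (-a) a := by
  intro t ht
  by_contra hta
  have hnt : -t ∉ Icc (-a) a := by
    intro h'
    apply hta
    simp only [mem_Icc] at h' ⊢
    constructor <;> linarith [h'.1, h'.2]
  have h0 : g =ᶠ[𝓝 (-t)] 0 := notMem_tsupport_iff_eventuallyEq.1 fun h'' ↦ hnt (h h'')
  have h1 : (fun t ↦ g (-t)) =ᶠ[𝓝 t] 0 :=
    ((continuous_neg.tendsto t).eventually h0).mono fun x hx ↦ by simpa using hx
  exact (notMem_tsupport_iff_eventuallyEq.2 h1) ht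

/-- The even part of a window function is supported in the window. [folklore] -/
theorem tsupport_evenPart_subset_Icc {g : ℝ → ℂ} {a : ℝ} (h : tsupport g ⊆ Icc (-a) a) :
    tsupport (fun t ↦ (g t + g (-t)) / 2) ⊆ Icc (-a) a := by
  intro t ht
  by_contra hta
  have h0 : g =ᶠ[𝓝 t] 0 := notMem_tsupport_iff_eventuallyEq.1 fun h' ↦ hta (h h')
  have h1 : (fun t ↦ g (-t)) =ᶠ[𝓝 t] 0 :=
    notMem_tsupport_iff_eventuallyEq.1 fun h' ↦ hta (tsupport_comp_neg_subset_Icc h h')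
  have h2 : (fun t ↦ (g t + g (-t)) / 2) =ᶠ[𝓝 t] 0 := by
    filter_upwards [h0, h1] with x hx0 hx1
    simp only [Pi.zero_apply] at hx0 hx1 ⊢
    rw [hx0, hx1]
    simp
  exact (notMem_tsupport_iff_eventuallyEq.2 h2) ht

/-- The odd part of a window function is supported in the window. [folklore] -/
theorem tsupport_oddPart_subset_Icc {g : ℝ → ℂ} {a : ℝ} (h : tsupport g ⊆ Icc (-a) a) :
    tsupport (fun t ↦ (g t - g (-t)) / 2) ⊆ Icc (-a) a := by
  intro t ht
  by_contra hta
  have h0 : g =ᶠ[𝓝 t] 0 := notMem_tsupport_iff_eventuallyEq.1 fun h' ↦ hta (h h')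
  have h1 : (fun t ↦ g (-t)) =ᶠ[𝓝 t] 0 :=
    notMem_tsupport_iff_eventuallyEq.1 fun h' ↦ hta (tsupport_comp_neg_subset_Icc h h')
  have h2 : (fun t ↦ (g t - g (-t)) / 2) =ᶠ[𝓝 t] 0 := by
    filter_upwards [h0, h1] with x hx0 hx1
    simp only [Pi.zero_apply] at hx0 hx1 ⊢
    rw [hx0, hx1]
    simp
  exact (notMem_tsupport_iff_eventuallyEq.2 h2) ht

/-- `∫ ‖f(-t)‖² = ∫ ‖f‖²`. [folklore] -/
theorem integral_norm_sq_comp_neg (f : ℝ → ℂ) : ∫ t, ‖f (-t)‖ ^ 2 = ∫ t, ‖f t‖ ^ 2 :=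
  integral_neg_eq_self (fun t ↦ ‖f t‖ ^ 2) volume

/-- `f(-·) ∈ L²` for `f ∈ L²`. [folklore] -/
theorem memLp_comp_neg {f : ℝ → ℂ} (hf : MemLp f 2) : MemLp (fun t ↦ f (-t)) 2 :=
  hf.comp_measurePreserving (Measure.measurePreserving_neg volume)

/-- **The reflection of a ground state is a ground state** (the minimising sequence `gₙ(-·)`;
`Q(g(-·)) = Q(g)`, `weilQuadratic_comp_neg`). [folklore] -/
theorem isWeilGroundState_comp_neg {a : ℝ} {u : ℝ → ℂ} (hu : IsWeilGroundState a u) :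
    IsWeilGroundState a (fun t ↦ u (-t)) := by
  obtain ⟨hmem, g, hg, hQ, hL⟩ := hu
  refine ⟨memLp_comp_neg hmem, fun n t ↦ g n (-t), fun n ↦ ⟨(hg n).1.comp_neg,
    tsupport_comp_neg_subset_Icc (hg n).2.1, ?_⟩, ?_, ?_⟩
  · rw [integral_norm_sq_comp_neg]
    exact (hg n).2.2
  · simpa only [weilQuadratic_comp_neg] using hQ
  · have he : ∀ n, ∫ t, ‖g n (-t) - u (-t)‖ ^ 2 = ∫ t, ‖g n t - u t‖ ^ 2 := fun n ↦
      integral_neg_eq_self (fun t ↦ ‖g n t - u t‖ ^ 2) volume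
    simpa only [he] using hL

/-! ### Even and odd parts in `L²` -/

/-- The even part of an `L²` function is in `L²`. [folklore] -/
theorem memLp_evenPart {f : ℝ → ℂ} (hf : MemLp f 2) : MemLp (fun t ↦ (f t + f (-t)) / 2) 2 := by
  have h := (hf.add (memLp_comp_neg hf)).const_mul (1 / 2 : ℂ)
  refine h.ae_eq (Eventually.of_forall fun t ↦ ?_)
  simp only [Pi.add_apply]
  ring

/-- The odd part of an `L²` function is in `L²`. [folklore] -/
theorem memLp_oddPart {f : ℝ → ℂ} (hf : MemLp f 2) : MemLp (fun t ↦ (f t - f (-t)) / 2) 2 := by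
  have h := (hf.sub (memLp_comp_neg hf)).const_mul (1 / 2 : ℂ)
  refine h.ae_eq (Eventually.of_forall fun t ↦ ?_)
  simp only [Pi.sub_apply]
  ring

/-- `‖f‖² ∈ L¹` for `f ∈ L²`. [folklore] -/
theorem integrable_norm_sq_of_memLp {f : ℝ → ℂ} (hf : MemLp f 2) :
    Integrable fun t ↦ ‖f t‖ ^ 2 :=
  (memLp_two_iff_integrable_sq_norm hf.1).1 hf

/-- **Pythagoras for the parity splitting**: `∫‖fᵉ‖² + ∫‖fᵒ‖² = ∫‖f‖²` for `f ∈ L²`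
(pointwise parallelogram law and `∫‖f(-·)‖² = ∫‖f‖²`). [folklore] -/
theorem integral_norm_sq_evenPart_add_oddPart_of_memLp {f : ℝ → ℂ} (hf : MemLp f 2) :
    (∫ t, ‖(f t + f (-t)) / 2‖ ^ 2) + ∫ t, ‖(f t - f (-t)) / 2‖ ^ 2 = ∫ t, ‖f t‖ ^ 2 := by
  have hi := integrable_norm_sq_of_memLp hf
  have hin : Integrable fun t ↦ ‖f (-t)‖ ^ 2 := hi.comp_neg
  have hie := integrable_norm_sq_of_memLp (memLp_evenPart hf)
  have hio := integrable_norm_sq_of_memLp (memLp_oddPart hf)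
  rw [← integral_add hie hio]
  have e1 : ∫ t, (‖(f t + f (-t)) / 2‖ ^ 2 + ‖(f t - f (-t)) / 2‖ ^ 2) =
      ∫ t, (‖f t‖ ^ 2 + ‖f (-t)‖ ^ 2) / 2 :=
    integral_congr_ae (Eventually.of_forall fun t ↦ norm_sq_half_add_add_norm_sq_half_sub _ _)
  rw [e1, integral_div, integral_add hi hin, integral_norm_sq_comp_neg]
  ring

/-- `∫‖fᵉ‖² ≤ ∫‖f‖²` for `f ∈ L²`. [folklore] -/
theorem integral_norm_sq_evenPart_le_of_memLp {f : ℝ → ℂ} (hf : MemLp f 2) :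
    ∫ t, ‖(f t + f (-t)) / 2‖ ^ 2 ≤ ∫ t, ‖f t‖ ^ 2 := by
  have h := integral_norm_sq_evenPart_add_oddPart_of_memLp hf
  have h0 : 0 ≤ ∫ t, ‖(f t - f (-t)) / 2‖ ^ 2 := integral_nonneg fun _ ↦ by positivity
  linarith

/-! ### The energy bound for window test functions -/

/-- `ε(a) ∫‖h‖² ≤ Re Q(h)` for every test function `h` supported in `[-a, a]` (the Rayleigh
quotient bound `weilGroundEnergy_le_div`, and `Q(0) = 0` in the degenerate case). [folklore] -/
theorem weilGroundEnergy_mul_integral_norm_sq_le {h : ℝ → ℂ} (hh : IsWeilTest h) {a : ℝ}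
    (hsupp : tsupport h ⊆ Icc (-a) a) :
    weilGroundEnergy a * ∫ t, ‖h t‖ ^ 2 ≤ (weilQuadratic h).re := by
  have hnn : 0 ≤ ∫ t, ‖h t‖ ^ 2 := integral_nonneg fun _ ↦ by positivity
  rcases hnn.eq_or_lt with h0 | hpos
  · have hz : h = 0 := hh.eq_zero_of_integral_norm_sq_eq_zero h0.symm
    have hQ : weilQuadratic h = 0 := by
      have e : (fun t : ℝ ↦ (0 : ℂ) * h t) = h := by
        funext t
        rw [hz]
        simp
      have := weilQuadratic_const_mul 0 h
      rw [e] at this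
      simpa using this
    rw [← h0, hQ]
    simp
  · have := weilGroundEnergy_le_div hh hsupp hpos
    rwa [le_div_iff₀ hpos] at this

/-! ### The normalised even part of a ground state is a ground state -/

/-- **The normalised even part of a ground state is a ground state.**  If `u` is a ground state
at the window `a` whose even part `uᵉ = ½(u + u(-·))` is not `0` in `L²`, then `uᵉ/‖uᵉ‖₂` is a
ground state at `a`.  Proof: for the minimising sequence `gₙ → u` with even/odd parts `eₙ, oₙ`,
`Re Q(gₙ) = Re Q(eₙ) + Re Q(oₙ)` and `‖eₙ‖² + ‖oₙ‖² = 1`, so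
`ε‖eₙ‖² ≤ Re Q(eₙ) ≤ Re Q(gₙ) - ε(1 - ‖eₙ‖²)`; `‖eₙ - uᵉ‖₂ ≤ ‖gₙ - u‖₂ → 0` gives
`‖eₙ‖² → ‖uᵉ‖² > 0` and `Re Q(eₙ) → ε‖uᵉ‖²`, whence `eₙ/‖eₙ‖₂` (eventually defined) is an
`L²`-normalised minimising sequence converging to `uᵉ/‖uᵉ‖₂`. [folklore] -/
theorem isWeilGroundState_evenPart {a : ℝ} {u : ℝ → ℂ} (hu : IsWeilGroundState a u)
    (hN : 0 < ∫ t, ‖(u t + u (-t)) / 2‖ ^ 2) :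
    IsWeilGroundState a (fun t ↦
      (((Real.sqrt (∫ s, ‖(u s + u (-s)) / 2‖ ^ 2))⁻¹ : ℝ) : ℂ) * ((u t + u (-t)) / 2)) := by
  obtain ⟨hmem, g, hg, hQ, hL⟩ := hu
  set N : ℝ := ∫ s, ‖(u s + u (-s)) / 2‖ ^ 2 with hNdef
  set ε : ℝ := weilGroundEnergy a with hεdef
  -- even / odd parts of the minimising sequence and of `u`
  set e : ℕ → ℝ → ℂ := fun n t ↦ (g n t + g n (-t)) / 2 with hedef
  set o : ℕ → ℝ → ℂ := fun n t ↦ (g n t - g n (-t)) / 2 with hodef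
  set ue : ℝ → ℂ := fun t ↦ (u t + u (-t)) / 2 with huedef
  have hgm : ∀ n, MemLp (g n) 2 := fun n ↦
    (hg n).1.1.continuous.memLp_of_hasCompactSupport (hg n).1.2
  have het : ∀ n, IsWeilTest (e n) := fun n ↦ (hg n).1.evenPart
  have hot : ∀ n, IsWeilTest (o n) := fun n ↦ (hg n).1.oddPart
  have hes : ∀ n, tsupport (e n) ⊆ Icc (-a) a := fun n ↦ tsupport_evenPart_subset_Icc (hg n).2.1
  have hos : ∀ n, tsupport (o n) ⊆ Icc (-a) a := fun n ↦ tsupport_oddPart_subset_Icc (hg n).2.1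
  have hem : ∀ n, MemLp (e n) 2 := fun n ↦ memLp_evenPart (hgm n)
  have huem : MemLp ue 2 := memLp_evenPart hmem
  -- norms and energies split along parity
  set Ne : ℕ → ℝ := fun n ↦ ∫ t, ‖e n t‖ ^ 2 with hNedef
  have hsplit : ∀ n, Ne n + ∫ t, ‖o n t‖ ^ 2 = 1 := fun n ↦ by
    have := integral_norm_sq_evenPart_add_oddPart_of_memLp (hgm n)
    rw [(hg n).2.2] at this
    exact this
  have hQsplit : ∀ n, (weilQuadratic (g n)).re =
      (weilQuadratic (e n)).re + (weilQuadratic (o n)).re := fun n ↦ by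
    rw [weilQuadratic_eq_evenPart_add_oddPart (hg n).1, Complex.add_re]
  have hlow : ∀ n, ε * Ne n ≤ (weilQuadratic (e n)).re := fun n ↦
    weilGroundEnergy_mul_integral_norm_sq_le (het n) (hes n)
  have hupp : ∀ n, (weilQuadratic (e n)).re ≤ (weilQuadratic (g n)).re - ε * (1 - Ne n) := by
    intro n
    have h1 := weilGroundEnergy_mul_integral_norm_sq_le (hot n) (hos n)
    have h2 := hsplit n
    have h3 := hQsplit n
    have h4 : ∫ t, ‖o n t‖ ^ 2 = 1 - Ne n := by linarith
    rw [h4] at h1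
    linarith
  -- `eₙ → uᵉ` in `L²`
  have hD : Tendsto (fun n ↦ ∫ t, ‖e n t - ue t‖ ^ 2) atTop (𝓝 0) := by
    refine squeeze_zero (fun n ↦ integral_nonneg fun _ ↦ by positivity) (fun n ↦ ?_) hL
    have h1 := integral_norm_sq_evenPart_le_of_memLp ((hgm n).sub hmem)
    have e1 : (fun t ↦ ‖e n t - ue t‖ ^ 2) =
        fun t ↦ ‖((g n - u) t + (g n - u) (-t)) / 2‖ ^ 2 := by
      funext t
      simp only [hedef, huedef, Pi.sub_apply]
      congr 2
      ring
    rw [e1]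
    simpa only [Pi.sub_apply] using h1
  -- `‖eₙ‖² → N`
  have hNe : Tendsto Ne atTop (𝓝 N) := by
    have hsqrt : Tendsto (fun n ↦ Real.sqrt (∫ t, ‖e n t - ue t‖ ^ 2)) atTop (𝓝 0) := by
      simpa using hD.sqrt
    set S : ℝ := Real.sqrt N with hS
    have h1 : ∀ n, Real.sqrt (Ne n) ≤ S + Real.sqrt (∫ t, ‖e n t - ue t‖ ^ 2) := fun n ↦ by
      have := sqrt_integral_norm_sq_sub_le huem (huem.sub (hem n))
      simpa only [Pi.sub_apply, sub_sub_cancel, norm_sub_rev (ue _)] using this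
    have h2 : ∀ n, S ≤ Real.sqrt (Ne n) + Real.sqrt (∫ t, ‖e n t - ue t‖ ^ 2) := fun n ↦ by
      have := sqrt_integral_norm_sq_sub_le (hem n) ((hem n).sub huem)
      simpa only [Pi.sub_apply, sub_sub_cancel] using this
    have h3 : Tendsto (fun n ↦ Real.sqrt (Ne n)) atTop (𝓝 S) := by
      have hup : Tendsto (fun n ↦ S + Real.sqrt (∫ t, ‖e n t - ue t‖ ^ 2)) atTop (𝓝 S) := by
        simpa using tendsto_const_nhds.add hsqrt
      have hlo : Tendsto (fun n ↦ S - Real.sqrt (∫ t, ‖e n t - ue t‖ ^ 2)) atTop (𝓝 S) := by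
        simpa using tendsto_const_nhds.sub hsqrt
      exact tendsto_of_tendsto_of_tendsto_of_le_of_le hlo hup (fun n ↦ by linarith [h2 n])
        (fun n ↦ h1 n)
    have h4 : Tendsto (fun n ↦ Real.sqrt (Ne n) ^ 2) atTop (𝓝 (S ^ 2)) := h3.pow 2
    have h5 : ∀ n, Real.sqrt (Ne n) ^ 2 = Ne n := fun n ↦
      Real.sq_sqrt (integral_nonneg fun _ ↦ by positivity)
    simp only [h5] at h4
    rwa [hS, Real.sq_sqrt hN.le] at h4
  -- `Re Q(eₙ) → ε N`
  have hQe : Tendsto (fun n ↦ (weilQuadratic (e n)).re) atTop (𝓝 (ε * N)) := by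
    have hlo : Tendsto (fun n ↦ ε * Ne n) atTop (𝓝 (ε * N)) := tendsto_const_nhds.mul hNe
    have hup : Tendsto (fun n ↦ (weilQuadratic (g n)).re - ε * (1 - Ne n)) atTop
        (𝓝 (ε * N)) := by
      have h1 : Tendsto (fun n ↦ ε * (1 - Ne n)) atTop (𝓝 (ε * (1 - N))) :=
        tendsto_const_nhds.mul (tendsto_const_nhds.sub hNe)
      have h2 := hQ.sub h1
      convert h2 using 2
      ring
    exact tendsto_of_tendsto_of_tendsto_of_le_of_le hlo hup hlow hupp
  -- eventually `‖eₙ‖² > N/2`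
  obtain ⟨n₀, hn₀⟩ := eventually_atTop.1 (hNe.eventually (lt_mem_nhds (by linarith : N / 2 < N)))
  have hNepos : ∀ n, 0 < Ne (n + n₀) := fun n ↦ by
    have := hn₀ (n + n₀) (Nat.le_add_left _ _)
    linarith
  -- the normalised even parts
  set r : ℕ → ℝ := fun n ↦ (Real.sqrt (Ne (n + n₀)))⁻¹ with hrdef
  set R : ℝ := (Real.sqrt N)⁻¹ with hRdef
  have hrpos : ∀ n, 0 < r n := fun n ↦ inv_pos.2 (Real.sqrt_pos.2 (hNepos n))
  have hr2 : ∀ n, r n ^ 2 = (Ne (n + n₀))⁻¹ := fun n ↦ by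
    rw [hrdef]
    dsimp only
    rw [inv_pow, Real.sq_sqrt (hNepos n).le]
  have hrR : Tendsto r atTop (𝓝 R) :=
    ((hNe.comp (tendsto_add_atTop_nat n₀)).sqrt.inv₀ (Real.sqrt_ne_zero'.2 hN))
  refine ⟨huem.const_mul _, fun n t ↦ ((r n : ℝ) : ℂ) * e (n + n₀) t, fun n ↦
    ⟨(het _).const_mul _, tsupport_mul_subset_right.trans (hes _), ?_⟩, ?_, ?_⟩
  · -- normalisation
    simp only [norm_mul, mul_pow, Complex.norm_real, Real.norm_of_nonneg (hrpos n).le]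
    rw [integral_const_mul, hr2 n]
    exact inv_mul_cancel₀ (hNepos n).ne'
  · -- energies
    have key : ∀ n, (weilQuadratic (fun t ↦ ((r n : ℝ) : ℂ) * e (n + n₀) t)).re =
        (Ne (n + n₀))⁻¹ * (weilQuadratic (e (n + n₀))).re := fun n ↦ by
      rw [weilQuadratic_const_mul, Complex.normSq_ofReal, Complex.re_ofReal_mul, ← sq, hr2 n]
    have h1 : Tendsto (fun n ↦ (Ne (n + n₀))⁻¹ * (weilQuadratic (e (n + n₀))).re) atTop
        (𝓝 (N⁻¹ * (ε * N))) :=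
      ((hNe.comp (tendsto_add_atTop_nat n₀)).inv₀ hN.ne').mul
        (hQe.comp (tendsto_add_atTop_nat n₀))
    have h2 : N⁻¹ * (ε * N) = ε := by field_simp
    rw [h2] at h1
    exact h1.congr fun n ↦ (key n).symm
  · -- `L²` convergence to `R uᵉ`
    have hD' : Tendsto (fun n ↦ ∫ t, ‖e (n + n₀) t - ue t‖ ^ 2) atTop (𝓝 0) :=
      hD.comp (tendsto_add_atTop_nat n₀)
    have hNe' : Tendsto (fun n ↦ Ne (n + n₀)) atTop (𝓝 N) := hNe.comp (tendsto_add_atTop_nat n₀)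
    have hpt : ∀ n t, ‖((r n : ℝ) : ℂ) * e (n + n₀) t - (R : ℂ) * ue t‖ ^ 2 ≤
        2 * (r n - R) ^ 2 * ‖e (n + n₀) t‖ ^ 2 + 2 * R ^ 2 * ‖e (n + n₀) t - ue t‖ ^ 2 := by
      intro n t
      have e1 : ((r n : ℝ) : ℂ) * e (n + n₀) t - (R : ℂ) * ue t =
          ((r n - R : ℝ) : ℂ) * e (n + n₀) t + (R : ℂ) * (e (n + n₀) t - ue t) := by
        push_cast
        ring
      rw [e1]
      have h1 := norm_add_le (((r n - R : ℝ) : ℂ) * e (n + n₀) t) ((R : ℂ) * (e (n + n₀) t - ue t))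
      rw [norm_mul, norm_mul, Complex.norm_real, Complex.norm_real, Real.norm_eq_abs,
        Real.norm_eq_abs] at h1
      have h2 : 0 ≤ |r n - R| * ‖e (n + n₀) t‖ := by positivity
      have h3 : 0 ≤ |R| * ‖e (n + n₀) t - ue t‖ := by positivity
      calc ‖((r n - R : ℝ) : ℂ) * e (n + n₀) t + (R : ℂ) * (e (n + n₀) t - ue t)‖ ^ 2
          ≤ (|r n - R| * ‖e (n + n₀) t‖ + |R| * ‖e (n + n₀) t - ue t‖) ^ 2 :=
            pow_le_pow_left₀ (norm_nonneg _) h1 2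
        _ ≤ 2 * (|r n - R| * ‖e (n + n₀) t‖) ^ 2 + 2 * (|R| * ‖e (n + n₀) t - ue t‖) ^ 2 := by
            nlinarith [sq_nonneg (|r n - R| * ‖e (n + n₀) t‖ - |R| * ‖e (n + n₀) t - ue t‖)]
        _ = 2 * (r n - R) ^ 2 * ‖e (n + n₀) t‖ ^ 2 + 2 * R ^ 2 * ‖e (n + n₀) t - ue t‖ ^ 2 := by
            rw [mul_pow, mul_pow, sq_abs, sq_abs]; ring
    have hbound : ∀ n, ∫ t, ‖((r n : ℝ) : ℂ) * e (n + n₀) t - (R : ℂ) * ue t‖ ^ 2 ≤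
        2 * (r n - R) ^ 2 * Ne (n + n₀) + 2 * R ^ 2 * ∫ t, ‖e (n + n₀) t - ue t‖ ^ 2 := by
      intro n
      have hi1 : Integrable fun t ↦ ‖e (n + n₀) t‖ ^ 2 := integrable_norm_sq_of_memLp (hem _)
      have hi2 : Integrable fun t ↦ ‖e (n + n₀) t - ue t‖ ^ 2 :=
        integrable_norm_sq_of_memLp ((hem _).sub huem)
      have hi3 : Integrable fun t ↦
          2 * (r n - R) ^ 2 * ‖e (n + n₀) t‖ ^ 2 + 2 * R ^ 2 * ‖e (n + n₀) t - ue t‖ ^ 2 :=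
        (hi1.const_mul (2 * (r n - R) ^ 2)).add (hi2.const_mul (2 * R ^ 2))
      have := integral_mono_of_nonneg (Eventually.of_forall fun t ↦ by positivity) hi3
        (Eventually.of_forall (hpt n))
      rw [integral_add (hi1.const_mul _) (hi2.const_mul _), integral_const_mul,
        integral_const_mul] at this
      exact this
    have hlim0 : Tendsto (fun n ↦ 2 * (r n - R) ^ 2 * Ne (n + n₀) +
        2 * R ^ 2 * ∫ t, ‖e (n + n₀) t - ue t‖ ^ 2) atTop (𝓝 0) := by
      have h1 : Tendsto (fun n ↦ r n - R) atTop (𝓝 0) := by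
        simpa using hrR.sub_const R
      have h2 : Tendsto (fun n ↦ 2 * (r n - R) ^ 2 * Ne (n + n₀)) atTop (𝓝 (2 * 0 ^ 2 * N)) :=
        (tendsto_const_nhds.mul (h1.pow 2)).mul hNe'
      have h3 : Tendsto (fun n ↦ 2 * R ^ 2 * ∫ t, ‖e (n + n₀) t - ue t‖ ^ 2) atTop
          (𝓝 (2 * R ^ 2 * 0)) :=
        tendsto_const_nhds.mul hD'
      simpa using h2.add h3
    exact squeeze_zero (fun n ↦ integral_nonneg fun _ ↦ by positivity) hbound hlim0

end Summit.RiemannHypothesis.RiemannHypothesis.Theorems.GroundStatesConvergeToXi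

end
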